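import Mathlib
import Literature.Probability.Process.CondExpCauchySchwarzPythagoras
import Literature.Probability.Process.MartingaleL2Convergence
import HarnessLib

/-!
# Durrett §4.4, Exercises: gluing stopping times (4.4.3), `X_M ≤ E(X_N | 𝓕_M)` (4.4.4), the
# conditional variance formula along `𝓕 ⊂ 𝒢` (4.4.5), bilinear orthogonality of martingale
# increments (4.4.9) and the square-summable-increments convergence criterion (4.4.10)

[topic Probability/Process]

Discrete time, Mathlib's `Submartingale` / `Martingale` for a filtration `ℱ : Filtration ℕ m₀` on
a finite measure space; stopping times are `WithTop ℕ`-valued (`IsStoppingTime ℱ M`), `𝓕_M` is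
`hM.measurableSpace`, `X_M` is `stoppedValue X M`.

| Durrett 2019, §4.4, Exercises (pp. 215–216) | declaration | status |
|---|---|---|
| 4.4.1–4.4.2: `X` submartingale, `M ≤ N ≤ k` stopping times ⟹ `EX_M ≤ EX_N` | Mathlib's `MeasureTheory.Submartingale.expected_stoppedValue_mono` | not restated |
| 4.4.3: `M ≤ N` stopping times, `A ∈ 𝓕_M` ⟹ `L = M` on `A`, `= N` on `Aᶜ` is a stopping time | `Durrett2019_exercise_4_4_3` | proved |
| 4.4.4: then `X_M ≤ E(X_N | 𝓕_M)` | `Durrett2019_exercise_4_4_4` | proved |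
| 4.4.5: `𝓕 ⊂ 𝒢` ⟹ `E(E[Y|𝒢] − E[Y|𝓕])² = E(E[Y|𝒢])² − E(E[Y|𝓕])²` | `Durrett2019_exercise_4_4_5` | proved |
| 4.4.9: `EX_nY_n − EX_0Y_0 = Σ_{m=1}^n E(X_m − X_{m−1})(Y_m − Y_{m−1})` | `Durrett2019_exercise_4_4_9` | proved |
| 4.4.10: `EX_0², Σ Eξ_m² < ∞` ⟹ `X_n → X_∞` a.s. and in `L²` | `Durrett2019_exercise_4_4_10` | proved |

Not treated here: 4.4.6–4.4.8 (maximal-inequality exercises) and 4.4.11 (needs Kronecker's lemma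
with denominator `b_n`; the tree's `Durrett2019_thm_2_5_9` divides by the next weight).

Proofs.  4.4.3: `{L ≤ n} = (A ∩ {M ≤ n}) ∪ (Aᶜ ∩ {M ≤ n} ∩ {N ≤ n})` since `M ≤ N`.  4.4.4 (as
Durrett suggests, from 4.4.2 and 4.4.3): for `A ∈ 𝓕_M`, `EX_L ≤ EX_N` for the glued time `L`
reads `E(X_M; A) ≤ E(X_N; A)` (`setIntegral_stoppedValue_le_of_le`), and `X_M` is
`𝓕_M`-measurable.  4.4.5: Exercise 4.1.9's identity `E(Z − E(Z|𝓕))² = EZ² − E(E(Z|𝓕))²`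
(`integral_sub_condExp_sq_eq_sub`) for `Z = E(Y|𝒢)`, plus the tower property.  4.4.9: expand
`(X_{m+1} − X_m)(Y_{m+1} − Y_m)` and kill the two mixed terms by Theorem 4.4.7 (orthogonality of
martingale increments, the tree's `Durrett2019_thm_4_4_7`), then telescope.  4.4.10: 4.4.9 with
`Y = X` gives `EX_n² = EX_0² + Σ_{m<n} Eξ_{m+1}² ≤ EX_0² + Σ_m Eξ_m²`, so `sup ‖X_n‖₂ < ∞` and
Theorem 4.4.6 (the tree's `Durrett2019_thm_4_4_6`) applies.

## References
* [Durrett2019] R. Durrett, *Probability: Theory and Examples*, 5th ed., Cambridge Series in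
  Statistical and Probabilistic Mathematics 49, Cambridge University Press (2019): §4.4 (Doob's
  inequality, convergence in `L^p`, `p > 1`), Exercises 4.4.1–4.4.5, 4.4.9, 4.4.10, pp. 215–216;
  Theorems 4.4.6–4.4.7, p. 214.
-/

namespace Literature.Probability.Process

open _root_.MeasureTheory _root_.ProbabilityTheory Filter
open scoped ENNReal NNReal Topology

variable {Ω : Type*} {m₀ : MeasurableSpace Ω} {μ : Measure Ω} {ℱ : Filtration ℕ m₀}

/-! ## Exercise 4.4.3: gluing two stopping times along an `𝓕_M`-set -/

/-- **Durrett, Exercise 4.4.3.** Suppose `M ≤ N` are stopping times.  If `A ∈ 𝓕_M`, then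
`L = M` on `A`, `L = N` on `Aᶜ` is a stopping time. [cite: Durrett2019, §4.4 Exercise 4.4.3, p. 215] -/
theorem Durrett2019_exercise_4_4_3 {M N : Ω → WithTop ℕ} (hM : IsStoppingTime ℱ M)
    (hN : IsStoppingTime ℱ N) (hMN : M ≤ N) {A : Set Ω}
    (hA : MeasurableSet[hM.measurableSpace] A) [DecidablePred (· ∈ A)] :
    IsStoppingTime ℱ (A.piecewise M N) := by
  intro n
  have hA' := (hM.measurableSet A).1 hA
  have hAc := (hM.measurableSet Aᶜ).1 hA.compl
  have e : {ω | A.piecewise M N ω ≤ n} =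
      (A ∩ {ω | M ω ≤ n}) ∪ ((Aᶜ ∩ {ω | M ω ≤ n}) ∩ {ω | N ω ≤ n}) := by
    ext ω
    by_cases hω : ω ∈ A
    · simp only [Set.mem_setOf_eq, Set.piecewise_eq_of_mem _ _ _ hω, Set.mem_union,
        Set.mem_inter_iff, hω, true_and, Set.mem_compl_iff, not_true_eq_false, false_and,
        or_false]
    · simp only [Set.mem_setOf_eq, Set.piecewise_eq_of_notMem _ _ _ hω, Set.mem_union,
        Set.mem_inter_iff, hω, false_and, Set.mem_compl_iff, not_false_eq_true, true_and,
        false_or]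
      exact ⟨fun h => ⟨(hMN ω).trans h, h⟩, fun h => h.2⟩
  have key : MeasurableSet[ℱ n]
      ((A ∩ {ω | M ω ≤ n}) ∪ ((Aᶜ ∩ {ω | M ω ≤ n}) ∩ {ω | N ω ≤ n})) :=
    (hA'.2 n).union ((hAc.2 n).inter (hN n))
  rw [← e] at key
  exact key

/-! ## Exercise 4.4.4: `X_M ≤ E(X_N | 𝓕_M)` -/

/-- `stoppedValue` of a glued time, pointwise. [cite: Durrett2019, §4.4 Exercise 4.4.4, p. 215 (proof step)] -/
theorem stoppedValue_piecewise_apply {X : ℕ → Ω → ℝ} {M N : Ω → WithTop ℕ} {A : Set Ω}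
    [DecidablePred (· ∈ A)] (ω : Ω) :
    stoppedValue X (A.piecewise M N) ω =
      if ω ∈ A then stoppedValue X M ω else stoppedValue X N ω := by
  by_cases h : ω ∈ A
  · simp only [stoppedValue, Set.piecewise_eq_of_mem _ _ _ h, if_pos h]
  · simp only [stoppedValue, Set.piecewise_eq_of_notMem _ _ _ h, if_neg h]

/-- **Exercise 4.4.2 applied to the glued time of Exercise 4.4.3**: for a submartingale `X`,
stopping times `M ≤ N ≤ k` and `A ∈ 𝓕_M`, `E(X_M; A) ≤ E(X_N; A)` (from `EX_L ≤ EX_N`, Mathlib's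
`Submartingale.expected_stoppedValue_mono`, with `L = M 1_A + N 1_{Aᶜ}`).
[cite: Durrett2019, §4.4 Exercises 4.4.2–4.4.4, p. 215 (proof step)] -/
theorem setIntegral_stoppedValue_le_of_le [IsFiniteMeasure μ] {X : ℕ → Ω → ℝ}
    (hX : Submartingale X ℱ μ) {M N : Ω → WithTop ℕ} (hM : IsStoppingTime ℱ M)
    (hN : IsStoppingTime ℱ N) (hMN : M ≤ N) {k : ℕ} (hNk : ∀ ω, N ω ≤ k) {A : Set Ω}
    (hA : MeasurableSet[hM.measurableSpace] A) :
    ∫ ω in A, stoppedValue X M ω ∂μ ≤ ∫ ω in A, stoppedValue X N ω ∂μ := by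
  classical
  have hL : IsStoppingTime ℱ (A.piecewise M N) := Durrett2019_exercise_4_4_3 hM hN hMN hA
  have hLN : A.piecewise M N ≤ N := fun ω => by
    by_cases h : ω ∈ A
    · rw [Set.piecewise_eq_of_mem _ _ _ h]; exact hMN ω
    · rw [Set.piecewise_eq_of_notMem _ _ _ h]
  have hmono := hX.expected_stoppedValue_mono hL hN hLN hNk
  have hA₀ : MeasurableSet A := ((hM.measurableSet A).1 hA).1
  have hiN : Integrable (stoppedValue X N) μ := integrable_stoppedValue ℕ hN hX.integrable hNk
  have hiL : Integrable (stoppedValue X (A.piecewise M N)) μ :=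
    integrable_stoppedValue ℕ hL hX.integrable fun ω => (hLN ω).trans (hNk ω)
  have hsplitL : ∫ ω, stoppedValue X (A.piecewise M N) ω ∂μ =
      ∫ ω in A, stoppedValue X M ω ∂μ + ∫ ω in Aᶜ, stoppedValue X N ω ∂μ := by
    rw [← integral_add_compl hA₀ hiL]
    congr 1
    · exact setIntegral_congr_fun hA₀ fun ω hω => by
        rw [stoppedValue_piecewise_apply, if_pos hω]
    · exact setIntegral_congr_fun hA₀.compl fun ω hω => by
        rw [stoppedValue_piecewise_apply, if_neg (Set.notMem_of_mem_compl hω)]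
  have hsplitN : ∫ ω, stoppedValue X N ω ∂μ =
      ∫ ω in A, stoppedValue X N ω ∂μ + ∫ ω in Aᶜ, stoppedValue X N ω ∂μ :=
    (integral_add_compl hA₀ hiN).symm
  rw [hsplitL, hsplitN] at hmono
  linarith

/-- **Durrett, Exercise 4.4.4.** If `X_n` is a submartingale and `M ≤ N` are stopping times with
`P(N ≤ k) = 1` (here: `N ≤ k` everywhere), then `X_M ≤ E(X_N | 𝓕_M)` ("use the stopping times from
the previous exercise to strengthen the conclusion of Exercise 4.4.2").
[cite: Durrett2019, §4.4 Exercise 4.4.4, p. 215] -/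
theorem Durrett2019_exercise_4_4_4 [IsFiniteMeasure μ] {X : ℕ → Ω → ℝ} (hX : Submartingale X ℱ μ)
    {M N : Ω → WithTop ℕ} (hM : IsStoppingTime ℱ M) (hN : IsStoppingTime ℱ N) (hMN : M ≤ N)
    {k : ℕ} (hNk : ∀ ω, N ω ≤ k) :
    stoppedValue X M ≤ᵐ[μ] μ[stoppedValue X N | hM.measurableSpace] := by
  have hle : hM.measurableSpace ≤ m₀ := hM.measurableSpace_le
  have hiM : Integrable (stoppedValue X M) μ :=
    integrable_stoppedValue ℕ hM hX.integrable fun ω => (hMN ω).trans (hNk ω)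
  have hiN : Integrable (stoppedValue X N) μ := integrable_stoppedValue ℕ hN hX.integrable hNk
  have hXM : StronglyMeasurable[hM.measurableSpace] (stoppedValue X M) :=
    (measurable_stoppedValue hX.1.isStronglyProgressive_of_discrete hM).stronglyMeasurable
  suffices h : stoppedValue X M ≤ᵐ[μ.trim hle] μ[stoppedValue X N | hM.measurableSpace] from
    ae_le_of_ae_le_trim h
  suffices h : 0 ≤ᵐ[μ.trim hle] μ[stoppedValue X N | hM.measurableSpace] - stoppedValue X M by
    filter_upwards [h] with ω hω
    rwa [← sub_nonneg]
  refine ae_nonneg_of_forall_setIntegral_nonneg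
    ((integrable_condExp.sub hiM).trim hle (stronglyMeasurable_condExp.sub hXM)) fun s hs _ => ?_
  rw [← setIntegral_trim hle (stronglyMeasurable_condExp.sub hXM) hs,
    integral_sub' integrable_condExp.integrableOn hiM.integrableOn, sub_nonneg,
    setIntegral_condExp hle hiN hs]
  exact setIntegral_stoppedValue_le_of_le hX hM hN hMN hNk hs

/-! ## Exercise 4.4.5: the conditional variance formula along `𝓕 ⊂ 𝒢` -/

/-- **Durrett, Exercise 4.4.5** (a variant of the conditional variance formula).  If `𝓕 ⊂ 𝒢`,
then `E(E[Y|𝒢] − E[Y|𝓕])² = E(E[Y|𝒢])² − E(E[Y|𝓕])²` (for `EY² < ∞`; here `mF = 𝓕 ≤ mG = 𝒢`).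
[cite: Durrett2019, §4.4 Exercise 4.4.5, p. 215] -/
theorem Durrett2019_exercise_4_4_5 [IsFiniteMeasure μ] {mF mG : MeasurableSpace Ω} (hFG : mF ≤ mG)
    (hG : mG ≤ m₀) {Y : Ω → ℝ} (hY : MemLp Y 2 μ) :
    ∫ ω, ((μ[Y | mG]) ω - (μ[Y | mF]) ω) ^ 2 ∂μ =
      ∫ ω, (μ[Y | mG]) ω ^ 2 ∂μ - ∫ ω, (μ[Y | mF]) ω ^ 2 ∂μ := by
  have hY' : MemLp (μ[Y | mG]) 2 μ := hY.condExp one_le_two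
  have h1 := integral_sub_condExp_sq_eq_sub (μ := μ) (m := mF) (hFG.trans hG) hY'
  have htower : μ[μ[Y | mG] | mF] =ᵐ[μ] μ[Y | mF] := condExp_condExp_of_le hFG hG
  have e1 : ∫ ω, ((μ[Y | mG]) ω - (μ[μ[Y | mG] | mF]) ω) ^ 2 ∂μ =
      ∫ ω, ((μ[Y | mG]) ω - (μ[Y | mF]) ω) ^ 2 ∂μ :=
    integral_congr_ae (htower.mono fun ω hω => by
      show ((μ[Y | mG]) ω - (μ[μ[Y | mG] | mF]) ω) ^ 2 = ((μ[Y | mG]) ω - (μ[Y | mF]) ω) ^ 2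
      rw [hω])
  have e2 : ∫ ω, (μ[μ[Y | mG] | mF]) ω ^ 2 ∂μ = ∫ ω, (μ[Y | mF]) ω ^ 2 ∂μ :=
    integral_congr_ae (htower.mono fun ω hω => by
      show (μ[μ[Y | mG] | mF]) ω ^ 2 = (μ[Y | mF]) ω ^ 2
      rw [hω])
  rw [← e1, h1, e2]

/-! ## Exercise 4.4.9: bilinear orthogonality of martingale increments -/

/-- **Durrett, Exercise 4.4.9.** Let `X_n` and `Y_n` be martingales with `EX_n², EY_n² < ∞`.  Then
`EX_nY_n − EX_0Y_0 = Σ_{m=1}^n E(X_m − X_{m−1})(Y_m − Y_{m−1})`.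
[cite: Durrett2019, §4.4 Exercise 4.4.9, p. 216] -/
theorem Durrett2019_exercise_4_4_9 [IsFiniteMeasure μ] {X Y : ℕ → Ω → ℝ} (hX : Martingale X ℱ μ)
    (hY : Martingale Y ℱ μ) (hX2 : ∀ n, MemLp (X n) 2 μ) (hY2 : ∀ n, MemLp (Y n) 2 μ) (n : ℕ) :
    ∫ ω, X n ω * Y n ω ∂μ - ∫ ω, X 0 ω * Y 0 ω ∂μ =
      ∑ m ∈ Finset.range n, ∫ ω, (X (m + 1) ω - X m ω) * (Y (m + 1) ω - Y m ω) ∂μ := by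
  have hstep : ∀ m, ∫ ω, (X (m + 1) ω - X m ω) * (Y (m + 1) ω - Y m ω) ∂μ =
      ∫ ω, X (m + 1) ω * Y (m + 1) ω ∂μ - ∫ ω, X m ω * Y m ω ∂μ := by
    intro m
    have o1 : ∫ ω, (X (m + 1) ω - X m ω) * Y m ω ∂μ = 0 :=
      Durrett2019_thm_4_4_7 hX hX2 m.le_succ (hY.stronglyAdapted m) (hY2 m)
    have o2 : ∫ ω, (Y (m + 1) ω - Y m ω) * X m ω ∂μ = 0 :=
      Durrett2019_thm_4_4_7 hY hY2 m.le_succ (hX.stronglyAdapted m) (hX2 m)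
    have e : ∀ ω, (X (m + 1) ω - X m ω) * (Y (m + 1) ω - Y m ω) =
        (X (m + 1) ω * Y (m + 1) ω - X m ω * Y m ω) - (X (m + 1) ω - X m ω) * Y m ω -
          (Y (m + 1) ω - Y m ω) * X m ω := fun ω => by ring
    have i11 : Integrable (fun ω => X (m + 1) ω * Y (m + 1) ω) μ :=
      (hX2 _).integrable_mul (hY2 _)
    have i00 : Integrable (fun ω => X m ω * Y m ω) μ := (hX2 _).integrable_mul (hY2 _)
    have iA : Integrable (fun ω => (X (m + 1) ω - X m ω) * Y m ω) μ :=
      ((hX2 _).sub (hX2 _)).integrable_mul (hY2 _)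
    have iB : Integrable (fun ω => (Y (m + 1) ω - Y m ω) * X m ω) μ :=
      ((hY2 _).sub (hY2 _)).integrable_mul (hX2 _)
    have iC : Integrable (fun ω => X (m + 1) ω * Y (m + 1) ω - X m ω * Y m ω) μ := i11.sub i00
    have iD : Integrable (fun ω => X (m + 1) ω * Y (m + 1) ω - X m ω * Y m ω -
        (X (m + 1) ω - X m ω) * Y m ω) μ := iC.sub iA
    rw [show (fun ω => (X (m + 1) ω - X m ω) * (Y (m + 1) ω - Y m ω)) = fun ω =>
        (X (m + 1) ω * Y (m + 1) ω - X m ω * Y m ω) - (X (m + 1) ω - X m ω) * Y m ω -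
          (Y (m + 1) ω - Y m ω) * X m ω from funext e,
      integral_sub iD iB, integral_sub iC iA, integral_sub i11 i00, o1, o2]
    ring
  simp_rw [hstep]
  exact (Finset.sum_range_sub (fun m => ∫ ω, X m ω * Y m ω ∂μ) n).symm

/-! ## Exercise 4.4.10: square-summable increments -/

/-- `‖f‖₂ ≤ √K` when `∫ f² ≤ K`. [cite: Durrett2019, §4.4 Exercise 4.4.10, p. 216 (proof step)] -/
theorem eLpNorm_two_le_sqrt_of_integral_sq_le {f : Ω → ℝ} (hf : MemLp f 2 μ) {K : ℝ}
    (hK : ∫ ω, f ω ^ 2 ∂μ ≤ K) : eLpNorm f 2 μ ≤ ((Real.sqrt K).toNNReal : ℝ≥0∞) := by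
  rw [hf.eLpNorm_eq_integral_rpow_norm two_ne_zero ENNReal.ofNat_ne_top, ENNReal.toReal_ofNat]
  have e : ∫ a, ‖f a‖ ^ (2 : ℝ) ∂μ = ∫ a, f a ^ 2 ∂μ := by
    refine integral_congr_ae (ae_of_all _ fun a => ?_)
    simp only [Real.norm_eq_abs, Real.rpow_two, sq_abs]
  rw [e, show (((Real.sqrt K).toNNReal : ℝ≥0) : ℝ≥0∞) = ENNReal.ofReal (Real.sqrt K) from rfl]
  refine ENNReal.ofReal_le_ofReal ?_
  rw [Real.sqrt_eq_rpow, show ((2 : ℝ)⁻¹) = 1 / 2 by norm_num]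
  exact Real.rpow_le_rpow (integral_nonneg fun _ => sq_nonneg _) hK (by norm_num)

/-- **Durrett, Exercise 4.4.10.** Let `X_n, n ≥ 0`, be a martingale and `ξ_n = X_n − X_{n−1}`.  If
`EX_0², Σ_{m ≥ 1} Eξ_m² < ∞`, then `X_n → X_∞` a.s. and in `L²` (here `X_∞ = ℱ.limitProcess X μ`).
[cite: Durrett2019, §4.4 Exercise 4.4.10, p. 216] -/
theorem Durrett2019_exercise_4_4_10 [IsFiniteMeasure μ] {X : ℕ → Ω → ℝ} (hX : Martingale X ℱ μ)
    (hX2 : ∀ n, MemLp (X n) 2 μ)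
    (hsum : Summable fun m => ∫ ω, (X (m + 1) ω - X m ω) ^ 2 ∂μ) :
    (∀ᵐ ω ∂μ, Tendsto (fun n => X n ω) atTop (𝓝 (ℱ.limitProcess X μ ω))) ∧
      MemLp (ℱ.limitProcess X μ) 2 μ ∧
      Tendsto (fun n => eLpNorm (X n - ℱ.limitProcess X μ) 2 μ) atTop (𝓝 0) := by
  have hsq : ∀ n, ∫ ω, X n ω ^ 2 ∂μ =
      ∫ ω, X 0 ω ^ 2 ∂μ + ∑ m ∈ Finset.range n, ∫ ω, (X (m + 1) ω - X m ω) ^ 2 ∂μ := by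
    intro n
    have h := Durrett2019_exercise_4_4_9 hX hX hX2 hX2 n
    simp only [← pow_two] at h
    linarith
  set K : ℝ := ∫ ω, X 0 ω ^ 2 ∂μ + ∑' m, ∫ ω, (X (m + 1) ω - X m ω) ^ 2 ∂μ with hKdef
  have hK : ∀ n, ∫ ω, X n ω ^ 2 ∂μ ≤ K := fun n => by
    rw [hsq n, hKdef]
    exact add_le_add le_rfl
      (hsum.sum_le_tsum (Finset.range n) fun m _ => integral_nonneg fun ω => sq_nonneg _)
  have hbdd : ∀ n, eLpNorm (X n) 2 μ ≤ (Real.sqrt K).toNNReal := fun n =>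
    eLpNorm_two_le_sqrt_of_integral_sq_le (hX2 n) (hK n)
  obtain ⟨h1, h2, -, h4⟩ := Durrett2019_thm_4_4_6 hX hbdd
  exact ⟨h1, h2, h4⟩

end Literature.Probability.Process
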